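import Summits.AtomisticToContinuum.BoseEinsteinCondensation.Theorems.BECDyadicChainingDyadicCoherenceDefectLevelIncrement
import Literature.MathematicalPhysics.QuantumManyBody.BoseGasCatStates
import HarnessLib

/-!
# Crux `DyadicCoherenceDefect` (stmt-AtomisticToContinuum-13192), line `registered`:
# free-gas Haar bands I — pairings of the flat cell modes with the sine product

Supports (does not close) stmt-AtomisticToContinuum-13192. First of three files establishing that the
hypothesis `0 < scatteringLength v` of the line's open stub S1″ (`stub_haarBandAboveKineticWindow`,
Haar-band occupation of Dirichlet near-minimisers above the kinetic window) is NECESSARY: without it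
the stub is false, witnessed by the free gas (`…FreeHaarBand.lean`). This file computes, in closed
form, everything about the free condensate profile that the witness needs:

* `occupation_powFun`, `cohSum_powFun` — occupations of a product state `u^{⊗N}`:
  `⟨φ, γ φ⟩ = N|⟨φ,u⟩|²`, so the level sums are `T_k = N ∑_m |⟨dyMode_{k,m}, u⟩|²`;
* `setIntegral_dyCell_prod`, `setIntegral_Ico_sin` — Fubini over a dyadic cell for tensor products,
  and `∫ sin(πt/L)` over an interval;
* `integral_conj_dyMode_sineMode` — `⟨dyMode_{k,m}, s⟩` for the normalised sine product
  `s(x) = 1_{Λ_L}(x) ∏_q (2/L)^{1/2} sin(πx_q/L)` in closed form (cosine differences), with squared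
  modulus `8·8^k/π⁶ ∏_q Δ_q²` (`norm_sq_flatAmp_mul_prod`);
* `sum_norm_sq_pairing_one` — level one: `∑_m |⟨dyMode_{1,m}, s⟩|² = 512/π⁶ = (8/π²)³ ≈ 0.533`
  (the zero-mode fraction of the free Dirichlet gas: level 1 carries no Haar band by symmetry);
* `sum_norm_sq_pairing_two` — level two: `∑_m |⟨dyMode_{2,m}, s⟩|² = (512/π⁶)(4 − 2√2)³ ≈ 0.857`
  (`sum_sq_cosDiff_two`: `∑_a (cos(πa/4) − cos(π(a+1)/4))² = 4 − 2√2`).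

So the level-two Haar band of the free condensate is `≈ 0.32 N`, macroscopic. All `[folklore]`.

## References

* [LSSY2005] E. H. Lieb, R. Seiringer, J. P. Solovej, J. Yngvason, *The Mathematics of the Bose Gas
  and its Condensation*, Birkhäuser 2005: §1.2 (1.17) (occupations / one-particle density matrix);
  Ch. 2, (2.3) and the remark after (2.50) (free Dirichlet ground state `∏ sin`, energy `3Nπ²/L²`,
  gap `3π²/L²`).
-/

noncomputable section

namespace Summit.AtomisticToContinuum.BoseEinsteinCondensation.Cruxes.DyadicCoherenceDefect.Birth

open Filter MeasureTheory
open scoped ENNReal NNReal BigOperators ComplexConjugate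
open Literature.MathematicalPhysics.QuantumManyBody.BoseGas
open Summit.AtomisticToContinuum.BoseEinsteinCondensation.Theses

namespace FreeHaarBand

variable {n : ℕ} {L : ℝ}

/-! ### Occupations of a product state -/

/-- **Occupation of a mode in a product state**: `⟨φ, γ_{u^{⊗(n+1)}} φ⟩ = (n+1) |⟨φ, u⟩|²` for a
normalised `C¹` one-body mode `u`. [folklore] -/
theorem occupation_powFun {u : Space → ℂ} (hu : ContDiff ℝ 1 (oneFun u))
    (h1 : ∫⁻ Y, (‖oneFun u Y‖₊ : ℝ≥0∞) ^ 2 = 1) (φ : Space → ℂ) (n : ℕ) :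
    occupation (n + 1) φ (powFun u (n + 1)) =
      (n + 1 : ℝ≥0∞) * (‖∫ x, conj (φ x) * u x‖₊ : ℝ≥0∞) ^ 2 := by
  unfold occupation
  have hY : ∀ Y : Config n, ∫ x, conj (φ x) * powFun u (n + 1) (Matrix.vecCons x Y) =
      (∫ x, conj (φ x) * u x) * powFun u n Y := by
    intro Y
    simp_rw [powFun_vecCons]
    rw [← integral_mul_const]
    congr 1
    funext x
    ring
  simp_rw [hY, nnnorm_mul, ENNReal.coe_mul, mul_pow]
  rw [lintegral_const_mul' _ _ (ENNReal.pow_ne_top ENNReal.coe_ne_top), lintegral_powFun_sq hu h1 n,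
    mul_one]

/-- The level-`k` coherent sum of a product state: `T_k(u^{⊗(n+1)}) = (n+1) ∑_m |⟨dyMode_m, u⟩|²`.
[folklore] -/
theorem cohSum_powFun {u : Space → ℂ} (hu : ContDiff ℝ 1 (oneFun u))
    (h1 : ∫⁻ Y, (‖oneFun u Y‖₊ : ℝ≥0∞) ^ 2 = 1) (L : ℝ) (k n : ℕ) :
    cohSum (n + 1) L k (powFun u (n + 1)) =
      (n + 1 : ℝ≥0∞) * ∑ m : Fin 3 → Fin (2 ^ k), (‖∫ x, conj (dyMode L k m x) * u x‖₊ : ℝ≥0∞) ^ 2 := by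
  unfold cohSum
  simp_rw [occupation_powFun hu h1, Finset.mul_sum]

/-! ### Integrals of tensor products over dyadic cells -/

/-- Fubini over a dyadic cell for a tensor product of real one-dimensional factors:
`∫_{dyCell} ∏ⱼ f(xⱼ) dx = ∏ⱼ ∫_{[mⱼ s, (mⱼ+1) s)} f` (`s = L/2^k`), in `ℂ`. [folklore] -/
theorem setIntegral_dyCell_prod (L : ℝ) (k : ℕ) (m : Fin 3 → Fin (2 ^ k)) (f : ℝ → ℝ) :
    ∫ x in dyCell L k m, (∏ j, ((f (x j) : ℝ) : ℂ)) =
      ∏ j, (((∫ t in Set.Ico (((m j : ℕ) : ℝ) * (L / 2 ^ k)) ((((m j : ℕ) : ℝ) + 1) * (L / 2 ^ k)),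
        f t : ℝ) : ℂ)) := by
  set I : Fin 3 → Set ℝ := fun j => Set.Ico (((m j : ℕ) : ℝ) * (L / 2 ^ k))
    ((((m j : ℕ) : ℝ) + 1) * (L / 2 ^ k)) with hI
  have hcell : dyCell L k m = {x : Space | ∀ j, x j ∈ I j} := rfl
  -- the integrand as a product of one-dimensional indicator factors
  have hind : ∀ x : Space, (dyCell L k m).indicator (fun x : Space => ∏ j, ((f (x j) : ℝ) : ℂ)) x =
      ∏ j, (I j).indicator (fun t => ((f t : ℝ) : ℂ)) (x j) := by
    intro x
    by_cases hx : x ∈ dyCell L k m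
    · rw [Set.indicator_of_mem hx]
      refine Finset.prod_congr rfl fun j _ => ?_
      rw [Set.indicator_of_mem (show x j ∈ I j from (mem_dyCell_iff.1 hx) j)]
    · rw [Set.indicator_of_notMem hx]
      have : ∃ j, x j ∉ I j := by
        by_contra h
        push Not at h
        exact hx (mem_dyCell_iff.2 h)
      obtain ⟨j, hj⟩ := this
      exact (Finset.prod_eq_zero (Finset.mem_univ j) (Set.indicator_of_notMem hj _)).symm
  rw [← integral_indicator (measurableSet_dyCell L k m)]
  simp_rw [hind]
  calc ∫ x : Space, ∏ j, (I j).indicator (fun t => ((f t : ℝ) : ℂ)) (x j)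
      = ∫ z : Fin 3 → ℝ, ∏ j, (I j).indicator (fun t => ((f t : ℝ) : ℂ)) (z j) :=
        (EuclideanSpace.volume_preserving_symm_measurableEquiv_toLp (Fin 3)).integral_comp'
          (g := fun z : Fin 3 → ℝ => ∏ j, (I j).indicator (fun t => ((f t : ℝ) : ℂ)) (z j))
    _ = ∏ j, ∫ t, (I j).indicator (fun t => ((f t : ℝ) : ℂ)) t := by
        rw [integral_fintype_prod_volume_eq_prod]
    _ = _ := by
        refine Finset.prod_congr rfl fun j _ => ?_
        rw [integral_indicator measurableSet_Ico, ← integral_complex_ofReal]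

/-- The one-dimensional sine integrals: `∫_{[a,b)} sin(πt/L) dt = (L/π)(cos(πa/L) − cos(πb/L))`
for `a ≤ b`, `L ≠ 0`. [folklore] -/
theorem setIntegral_Ico_sin {L a b : ℝ} (hL : L ≠ 0) (hab : a ≤ b) :
    ∫ t in Set.Ico a b, Real.sin (Real.pi * t / L) =
      L / Real.pi * (Real.cos (Real.pi * a / L) - Real.cos (Real.pi * b / L)) := by
  have hc : Real.pi / L ≠ 0 := div_ne_zero Real.pi_ne_zero hL
  rw [integral_Ico_eq_integral_Ioc, ← intervalIntegral.integral_of_le hab]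
  have h1 : (fun t : ℝ => Real.sin (Real.pi * t / L)) = fun t => Real.sin (Real.pi / L * t) := by
    funext t; congr 1; ring
  rw [h1, intervalIntegral.integral_comp_mul_left (fun u => Real.sin u) hc, integral_sin]
  simp only [smul_eq_mul]
  rw [show Real.pi / L * a = Real.pi * a / L by ring, show Real.pi / L * b = Real.pi * b / L by ring]
  field_simp

/-! ### The free ground-state profile `s(x) = 1_{Λ_L}(x) ∏_q (2/L)^{1/2} sin(π x_q/L)` on the cells -/

/-- On a dyadic cell the box cut-off of the sine product is invisible: a point of the cell outside
the open box has a vanishing coordinate, where the sine vanishes. [folklore] -/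
theorem sineMode_eq_prod_of_mem_dyCell (hL : 0 < L) {k : ℕ} {m : Fin 3 → Fin (2 ^ k)} {x : Space}
    (hx : x ∈ dyCell L k m) :
    (box L).indicator (fun x : Space =>
        ∏ q : Fin 3, ((Real.sqrt (2 / L) * Real.sin (Real.pi * x q / L) : ℝ) : ℂ)) x =
      ∏ q : Fin 3, ((Real.sqrt (2 / L) * Real.sin (Real.pi * x q / L) : ℝ) : ℂ) := by
  by_cases hb : x ∈ box L
  · rw [Set.indicator_of_mem hb]
  · rw [Set.indicator_of_notMem hb]
    have hx' := mem_dyCell_iff.1 hx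
    have hq : ∃ q, x q ∉ Set.Ioo 0 L := by
      by_contra h
      push Not at h
      exact hb h
    obtain ⟨q, hq⟩ := hq
    have hs : 0 ≤ L / 2 ^ k := by positivity
    have h0 : 0 ≤ x q := le_trans (mul_nonneg (Nat.cast_nonneg _) hs) (hx' q).1
    have hlt : x q < L := by
      have h1 := (hx' q).2
      have h2 : (((m q : ℕ) : ℝ) + 1) * (L / 2 ^ k) ≤ L := by
        have h3 : ((m q : ℕ) : ℝ) + 1 ≤ 2 ^ k := by
          have := (m q).isLt
          exact_mod_cast this
        calc (((m q : ℕ) : ℝ) + 1) * (L / 2 ^ k) ≤ (2 : ℝ) ^ k * (L / 2 ^ k) :=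
              mul_le_mul_of_nonneg_right h3 hs
          _ = L := by field_simp
      linarith
    have hx0 : x q = 0 := by
      by_contra hne
      exact hq ⟨lt_of_le_of_ne h0 (Ne.symm hne), hlt⟩
    symm
    refine Finset.prod_eq_zero (Finset.mem_univ q) ?_
    simp [hx0]

/-- **Pairing of a flat cell mode with the sine product**, in closed form:
`⟨dyMode_{k,m}, s⟩ = (s_k³)^{-1/2} ∏_q (2/L)^{1/2} (L/π) (cos(π m_q/2^k) − cos(π (m_q+1)/2^k))`.
[folklore] -/
theorem integral_conj_dyMode_sineMode (hL : 0 < L) (k : ℕ) (m : Fin 3 → Fin (2 ^ k)) :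
    ∫ x, conj (dyMode L k m x) * (box L).indicator (fun x : Space =>
        ∏ q : Fin 3, ((Real.sqrt (2 / L) * Real.sin (Real.pi * x q / L) : ℝ) : ℂ)) x =
      ((Real.sqrt ((L / 2 ^ k) ^ 3))⁻¹ : ℂ) * ∏ q : Fin 3, ((Real.sqrt (2 / L) * (L / Real.pi *
        (Real.cos (Real.pi * ((m q : ℕ) : ℝ) / 2 ^ k) -
          Real.cos (Real.pi * (((m q : ℕ) : ℝ) + 1) / 2 ^ k))) : ℝ) : ℂ) := by
  rw [integral_conj_dyMode_mul]
  congr 1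
  rw [setIntegral_congr_fun (measurableSet_dyCell L k m)
    (fun x hx => sineMode_eq_prod_of_mem_dyCell hL hx),
    setIntegral_dyCell_prod L k m (fun t => Real.sqrt (2 / L) * Real.sin (Real.pi * t / L))]
  refine Finset.prod_congr rfl fun q _ => ?_
  have hs : 0 ≤ L / 2 ^ k := by positivity
  have hab : ((m q : ℕ) : ℝ) * (L / 2 ^ k) ≤ (((m q : ℕ) : ℝ) + 1) * (L / 2 ^ k) :=
    mul_le_mul_of_nonneg_right (by linarith) hs
  have harg : ∀ c : ℝ, Real.pi * (c * (L / 2 ^ k)) / L = Real.pi * c / 2 ^ k := fun c => by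
    field_simp
  rw [integral_const_mul, setIntegral_Ico_sin hL.ne' hab, harg, harg]

/-- The squared modulus of the closed form: `8 · 8^k/π⁶ · ∏_q Δ_q²`. [folklore] -/
theorem norm_sq_flatAmp_mul_prod (hL : 0 < L) (k : ℕ) (Δ : Fin 3 → ℝ) :
    ‖((Real.sqrt ((L / 2 ^ k) ^ 3))⁻¹ : ℂ) *
        ∏ q : Fin 3, ((Real.sqrt (2 / L) * (L / Real.pi * Δ q) : ℝ) : ℂ)‖ ^ 2 =
      8 * 8 ^ k / Real.pi ^ 6 * ∏ q : Fin 3, Δ q ^ 2 := by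
  have hs : 0 < L / 2 ^ k := by positivity
  have hs3 : 0 < (L / 2 ^ k) ^ 3 := by positivity
  have h2L : 0 ≤ 2 / L := by positivity
  rw [norm_mul, norm_prod, mul_pow, ← Finset.prod_pow, norm_inv, Complex.norm_real,
    Real.norm_of_nonneg (Real.sqrt_nonneg _), inv_pow, Real.sq_sqrt hs3.le]
  simp only [Complex.norm_real, Real.norm_eq_abs, sq_abs, mul_pow, Real.sq_sqrt h2L,
    Fin.prod_univ_three]
  have hπ : Real.pi ≠ 0 := Real.pi_ne_zero
  have h2k : (2 : ℝ) ^ k ≠ 0 := by positivity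
  have h8 : (8 : ℝ) ^ k = (2 ^ k) ^ 3 := by
    rw [← pow_mul, show (8 : ℝ) = 2 ^ 3 by norm_num, ← pow_mul, mul_comm]
  rw [h8]
  field_simp
  ring

/-- Level one: all eight pairings of the sine product have squared modulus `64/π⁶`
(`cos 0 − cos(π/2) = cos(π/2) − cos π = 1`). [folklore] -/
theorem norm_sq_pairing_one (hL : 0 < L) (m : Fin 3 → Fin (2 ^ 1)) :
    ‖((Real.sqrt ((L / 2 ^ 1) ^ 3))⁻¹ : ℂ) * ∏ q : Fin 3, ((Real.sqrt (2 / L) * (L / Real.pi *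
        (Real.cos (Real.pi * ((m q : ℕ) : ℝ) / 2 ^ 1) -
          Real.cos (Real.pi * (((m q : ℕ) : ℝ) + 1) / 2 ^ 1))) : ℝ) : ℂ)‖ ^ 2 =
      64 / Real.pi ^ 6 := by
  rw [norm_sq_flatAmp_mul_prod hL 1]
  have hΔ : ∀ q : Fin 3, (Real.cos (Real.pi * ((m q : ℕ) : ℝ) / 2 ^ 1) -
      Real.cos (Real.pi * (((m q : ℕ) : ℝ) + 1) / 2 ^ 1)) ^ 2 = 1 := by
    intro q
    have h2 : ∀ a : Fin 2, (Real.cos (Real.pi * ((a : ℕ) : ℝ) / 2 ^ 1) -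
        Real.cos (Real.pi * (((a : ℕ) : ℝ) + 1) / 2 ^ 1)) ^ 2 = 1 := by
      intro a
      fin_cases a
      · simp [Real.cos_pi_div_two]
      · have h : Real.pi * ((1 : ℝ) + 1) / 2 = Real.pi := by ring
        simp [h]
    exact h2 (m q)
  simp only [hΔ, Finset.prod_const_one]
  ring

/-- The level-two cosine differences `Δ_a = cos(πa/4) − cos(π(a+1)/4)`, `a = 0,…,3`, have
`∑_a Δ_a² = 4 − 2√2` (`Δ = (1 − √2/2, √2/2, √2/2, 1 − √2/2)`). [folklore] -/
theorem sum_sq_cosDiff_two :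
    ∑ a : Fin 4, (Real.cos (Real.pi * ((a : ℕ) : ℝ) / 2 ^ 2) -
        Real.cos (Real.pi * (((a : ℕ) : ℝ) + 1) / 2 ^ 2)) ^ 2 = 4 - 2 * Real.sqrt 2 := by
  have c0 : Real.cos (Real.pi * ((0 : ℕ) : ℝ) / 2 ^ 2) = 1 := by simp
  have c1 : Real.cos (Real.pi * (((0 : ℕ) : ℝ) + 1) / 2 ^ 2) = Real.sqrt 2 / 2 := by
    rw [show Real.pi * (((0 : ℕ) : ℝ) + 1) / 2 ^ 2 = Real.pi / 4 by simp; ring, Real.cos_pi_div_four]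
  have c1' : Real.cos (Real.pi * ((1 : ℕ) : ℝ) / 2 ^ 2) = Real.sqrt 2 / 2 := by
    rw [show Real.pi * ((1 : ℕ) : ℝ) / 2 ^ 2 = Real.pi / 4 by simp; ring, Real.cos_pi_div_four]
  have c2 : Real.cos (Real.pi * (((1 : ℕ) : ℝ) + 1) / 2 ^ 2) = 0 := by
    rw [show Real.pi * (((1 : ℕ) : ℝ) + 1) / 2 ^ 2 = Real.pi / 2 by simp; ring, Real.cos_pi_div_two]
  have c2' : Real.cos (Real.pi * ((2 : ℕ) : ℝ) / 2 ^ 2) = 0 := by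
    rw [show Real.pi * ((2 : ℕ) : ℝ) / 2 ^ 2 = Real.pi / 2 by simp; ring, Real.cos_pi_div_two]
  have c3 : Real.cos (Real.pi * (((2 : ℕ) : ℝ) + 1) / 2 ^ 2) = -(Real.sqrt 2 / 2) := by
    rw [show Real.pi * (((2 : ℕ) : ℝ) + 1) / 2 ^ 2 = Real.pi - Real.pi / 4 by simp; ring,
      Real.cos_pi_sub, Real.cos_pi_div_four]
  have c3' : Real.cos (Real.pi * ((3 : ℕ) : ℝ) / 2 ^ 2) = -(Real.sqrt 2 / 2) := by
    rw [show Real.pi * ((3 : ℕ) : ℝ) / 2 ^ 2 = Real.pi - Real.pi / 4 by simp; ring,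
      Real.cos_pi_sub, Real.cos_pi_div_four]
  have c4 : Real.cos (Real.pi * (((3 : ℕ) : ℝ) + 1) / 2 ^ 2) = -1 := by
    rw [show Real.pi * (((3 : ℕ) : ℝ) + 1) / 2 ^ 2 = Real.pi by simp; ring, Real.cos_pi]
  have hsq : Real.sqrt 2 ^ 2 = 2 := Real.sq_sqrt (by norm_num)
  simp only [Fin.sum_univ_four, Fin.val_zero, Fin.val_one, Fin.val_two,
    show ((3 : Fin 4) : ℕ) = 3 from rfl, c0, c1, c1', c2, c2', c3, c3', c4]
  nlinarith [hsq]

/-- Level two: `∑_m |⟨dyMode_{2,m}, s⟩|² = (512/π⁶)(4 − 2√2)³`. [folklore] -/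
theorem sum_norm_sq_pairing_two (hL : 0 < L) :
    ∑ m : Fin 3 → Fin (2 ^ 2), ‖((Real.sqrt ((L / 2 ^ 2) ^ 3))⁻¹ : ℂ) *
        ∏ q : Fin 3, ((Real.sqrt (2 / L) * (L / Real.pi *
          (Real.cos (Real.pi * ((m q : ℕ) : ℝ) / 2 ^ 2) -
            Real.cos (Real.pi * (((m q : ℕ) : ℝ) + 1) / 2 ^ 2))) : ℝ) : ℂ)‖ ^ 2 =
      512 / Real.pi ^ 6 * (4 - 2 * Real.sqrt 2) ^ 3 := by
  simp only [norm_sq_flatAmp_mul_prod hL 2]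
  rw [← Finset.mul_sum, ← sum_sq_cosDiff_two, Finset.sum_pow' Finset.univ _ 3]
  have hpi : (Fintype.piFinset fun _ : Fin 3 => (Finset.univ : Finset (Fin 4))) = Finset.univ :=
    Fintype.piFinset_univ
  rw [hpi]
  norm_num
  rfl

/-- Level one: `∑_m |⟨dyMode_{1,m}, s⟩|² = 512/π⁶`. [folklore] -/
theorem sum_norm_sq_pairing_one (hL : 0 < L) :
    ∑ m : Fin 3 → Fin (2 ^ 1), ‖((Real.sqrt ((L / 2 ^ 1) ^ 3))⁻¹ : ℂ) *
        ∏ q : Fin 3, ((Real.sqrt (2 / L) * (L / Real.pi *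
          (Real.cos (Real.pi * ((m q : ℕ) : ℝ) / 2 ^ 1) -
            Real.cos (Real.pi * (((m q : ℕ) : ℝ) + 1) / 2 ^ 1))) : ℝ) : ℂ)‖ ^ 2 =
      512 / Real.pi ^ 6 := by
  simp only [norm_sq_pairing_one hL, Finset.sum_const, Finset.card_univ, card_dyIndex,
    nsmul_eq_mul]
  norm_num
  ring

end FreeHaarBand

/-- **Helper sub-goal `stub_freeSinePairingSums`** (registered on the crux item so that this file lands
with `--supports`; NOT a skeleton stub — the skeleton's composition is unchanged): the level-one and
level-two pairing sums of the normalised sine product with the flat cell modes,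
`512/π⁶` and `(512/π⁶)(4 − 2√2)³`. [folklore] -/
theorem stub_freeSinePairingSums :
    ∀ L : ℝ, 0 < L → (∑ m : Fin 3 → Fin (2 ^ 1), ‖((Real.sqrt ((L / 2 ^ 1) ^ 3))⁻¹ : ℂ) * ∏ q : Fin 3, ((Real.sqrt (2 / L) * (L / Real.pi * (Real.cos (Real.pi * ((m q : ℕ) : ℝ) / 2 ^ 1) - Real.cos (Real.pi * (((m q : ℕ) : ℝ) + 1) / 2 ^ 1))) : ℝ) : ℂ)‖ ^ 2 = 512 / Real.pi ^ 6) ∧ (∑ m : Fin 3 → Fin (2 ^ 2), ‖((Real.sqrt ((L / 2 ^ 2) ^ 3))⁻¹ : ℂ) * ∏ q : Fin 3, ((Real.sqrt (2 / L) * (L / Real.pi * (Real.cos (Real.pi * ((m q : ℕ) : ℝ) / 2 ^ 2) - Real.cos (Real.pi * (((m q : ℕ) : ℝ) + 1) / 2 ^ 2))) : ℝ) : ℂ)‖ ^ 2 = 512 / Real.pi ^ 6 * (4 - 2 * Real.sqrt 2) ^ 3) :=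
  fun _ hL => ⟨FreeHaarBand.sum_norm_sq_pairing_one hL, FreeHaarBand.sum_norm_sq_pairing_two hL⟩

end Summit.AtomisticToContinuum.BoseEinsteinCondensation.Cruxes.DyadicCoherenceDefect.Birth

end
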